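import Mathlib.LinearAlgebra.Matrix.Adjugate
import Mathlib.LinearAlgebra.Matrix.ToLinearEquiv
import Mathlib.LinearAlgebra.FiniteDimensional.Lemmas
import Literature.Computability.AlgebraicComplexity.GKSS19Thm5HittingSets
import HarnessLib

/-!
# GKSS19 ‹Bootstrapping hitting sets›, I: the explicit hard family extracted from a short hitting set

Guo–Kumar–Saptharishi–Solomon, *Derandomization from algebraic hardness* (arXiv:1905.00091 = SIAM
J. Comput. 51 (2022)), ‹Bootstrapping hitting sets› (journal text, unnumbered restatable after
‹Thm 5›, arXiv p0005.txt:L44–p0006.txt:L2; = ECCC TR19-065r2 Thm 1.7; typed as the named fact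
`GKSS2019_bootstrapping` in `GKSS19HardnessToHittingSets.lean`). Its printed proof (§3.3, arXiv
p0013.txt:L56 – p0014.txt:L8): "Consider an arbitrary, large enough `s` and let `H_s` be the
hitting set for `𝒞(k, i-deg: s, s^δ)`; the hypothesis guarantees that `|H_s| ≤ (s+1)^k − 1 <
(s+1)^k`. From (thm:HS), we can then obtain a polynomial `P_s(z_1, …, z_k)` of individual degree at
most `s` that cannot be computed by circuits of size `s^δ`. Expressing this in terms of its total
degree `d ≤ ks`, we get that `P_s` is a degree `d` polynomial that requires circuits of size more
than `(d/k)^δ ≫ d^{δ/2}`. Hence, `{P_s}` is an explicit family of `k`-variate, degree-`d`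
polynomials that require circuits of size `d^{δ/2}`. Therefore, (thm:derand-from-k-var-lbs)
[‹Thm 5›] yields an explicit `poly_{δ,k}(s)`-sized hitting set for [`𝒞(s,s,s)`]."

This file (theorems + definitions with bodies, NO named facts) is the MATHEMATICAL half of that
argument, written so that the tree's `GKSS2019_thm_5_holds` (`GKSS19Thm5Explicit.lean`) applies,
and filling the two points print leaves implicit:

* WHICH polynomial `P_s` (print: "obtain a polynomial"; it must later be produced by a machine, so
  it is fixed here once and for all, by integer determinants only): the exponent vectors
  `e_0 < e_1 < ⋯` of `{0..s}^k` in the lexicographic order of the tree's `gridLists k (s+1)`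
  (`expVec`); the INTEGER evaluation matrix `B_{a,i} = ∏_t num(a_t)^{e_i t} den(a_t)^{s − e_i t}
  = D_a · a^{e_i}` (`scaledEval`, `evalMatrix`, `cast_scaledEval`) at the points `a` of the list
  `H` (read as in `HittingSets.ListHits`, `ptOf`); the Gram matrices `Gram_j = B_jᵀ B_j` of the
  first `j` columns (`gram`); the FIRST SINGULAR PREFIX `j*` = least `j ≥ 1` with `det Gram_j = 0`
  (`firstSing`; it exists as soon as `|H| < (s+1)^k` — more columns than rows,
  `det_gram_eq_zero_of_lt`, `firstSing_le_of_lt`); the kernel vector `x` = LAST ADJUGATE COLUMN of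
  `Gram_{j*}` (`adjCol`, `kerCoeff`): `Gram_{j*} x = det • e = 0` (Mathlib `mul_adjugate`), hence
  `B_{j*} x = 0` over `ℚ` (`xᵀBᵀBx = |Bx|²`, `evalMatrix_mulVec_eq_zero`), and
  `x_{j*-1} = det Gram_{j*-1} ≠ 0` (`adjCol_last`, minimality); and
  **`vanishingPoly k s H = Σ_{i<j*} x_i z^{e_i}`** with `degreeOf_vanishingPoly_le` (`≤ s`),
  `eval_vanishingPoly_eq_zero` (vanishes on `H`), `vanishingPoly_ne_zero` (for `|H| < (s+1)^k`),
  and the hardness `lt_complexity_vanishingPoly`: if `H` hits `idegSlice ℚ k s t` then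
  `t < L(P_s)` — GKSS ‹Thm 15› ([HS80]) in the form used by §3.3.
* HOW the family is indexed by EXACT degree (the typed ‹Thm 5› asks `deg P_d = d` for every
  `d ≥ 1`, print indexes by `s` with `deg P_s` anywhere in `[1, ks]`): **`bootFamily k H₀ d =
  z_0^d + P_{s(d)}(z_1, …, z_k)`** in `k+1` variables with `s(d) = ⌊(d−1)/k⌋` (`sOf`), so that
  `deg = d` (`totalDegree_bootFamily`) and `L(P_{s(d)}) ≤ L(P'_d)` by the free substitution
  `z_0 := 0` (`complexity_vanishingPoly_le_bootFamily`, via the tree's `complexity_subst_C_le` and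
  `complexity_rename_of_injective_holds`); `eventually_hard_bootFamily`: `d^{δ/2} ≤ L(P'_d)` for
  `d ≥ max (k s₀ + 1) (4k²)` (print's "`(d/k)^δ ≫ d^{δ/2}`", here `s(d) ≥ d/(2k)` and `d ≥ 4k²`).

The EXPLICITNESS of `d ↦ bootFamily k H₀ d` in the dense representation (a `CodeFP` program around
the tree's polynomial-time integer determinant `IntDetFP.detZ_codeFP`) and the discharge
`GKSS2019_bootstrapping_holds` are the sequel files. Deviation from print (disclosed): `k+1`
variables instead of `k` (‹Thm 5› is applied with the constant `k+1`); everything else as printed.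
HONEST FRAMING: a formalization of a published 2019 theorem over `ℚ`; nothing here bears on
VP ≠ VNP.

## References
* [GuoKumarSaptharishiSolomon2019] arXiv:1905.00091, ‹Bootstrapping hitting sets› (p.5 L44 – p.6
  L2), §3.3 proof (p.13 L56 – p.14 L8), ‹Thm 15› (p.9 L47-48, [HS80]/[A05]).
* [HeintzSchnorr1980] J. Heintz, C.-P. Schnorr, *Testing polynomials which are easy to compute*,
  STOC 1980, Thm. 4.4 (hitting sets give hard polynomials; cited through GKSS ‹Thm 15›).
-/

noncomputable section

open MvPolynomial Matrix

namespace Literature.Computability.AlgebraicComplexity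

namespace GKSS2019

open Literature.Barriers.ValiantsHypothesis HittingSets

/-! ### Exponent vectors of `{0..s}^k` in lexicographic order -/

section Exponents

variable {k : ℕ}

/-- The `j`-th exponent vector of `{0, …, s}^k` in the lexicographic enumeration `gridLists k (s+1)`
(read with default `0`; the zero vector past the end). [cite: GuoKumarSaptharishiSolomon2019, §3.3 (arXiv p0013.txt:L57-60, "polynomial … of individual degree at most s")] -/
def expVec (k s j : ℕ) : Fin k → ℕ := fun i => ((gridLists k (s + 1)).getD j []).getD i 0

/-- The `j`-th exponent vector as a finitely supported function. [cite: GuoKumarSaptharishiSolomon2019, §3.3 (arXiv p0013.txt:L57-60)] -/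
def expFinsupp (k s j : ℕ) : Fin k →₀ ℕ := Finsupp.equivFunOnFinite.symm (expVec k s j)

/-- Unfolding `expFinsupp`. [cite: GuoKumarSaptharishiSolomon2019, §3.2–§3.3 (arXiv p0013.txt:L24-27, L57-60), proof step] -/
@[simp] theorem expFinsupp_apply (k s j : ℕ) (i : Fin k) : expFinsupp k s j i = expVec k s j i := by
  simp [expFinsupp]

/-- Entries of the exponent vectors are at most `s`. [cite: GuoKumarSaptharishiSolomon2019, §3.2–§3.3 (arXiv p0013.txt:L24-27, L57-60), proof step] -/
theorem expVec_le (k s j : ℕ) (i : Fin k) : expVec k s j i ≤ s := by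
  unfold expVec
  set l := (gridLists k (s + 1)).getD j [] with hl
  by_cases hj : j < (gridLists k (s + 1)).length
  · have hmem : l ∈ gridLists k (s + 1) := by
      rw [hl, List.getD_eq_getElem _ _ hj]; exact List.getElem_mem hj
    obtain ⟨hlen, hlt⟩ := mem_gridLists.mp hmem
    by_cases hi : (i : ℕ) < l.length
    · have := hlt _ (List.getElem_mem hi)
      rw [List.getD_eq_getElem _ _ hi]; omega
    · rw [List.getD_eq_default _ _ (not_lt.mp hi)]; exact Nat.zero_le _
  · rw [hl, List.getD_eq_default _ _ (not_lt.mp hj)]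
    simp

/-- `gridLists` has no duplicates. [cite: GuoKumarSaptharishiSolomon2019, §3.2–§3.3 (arXiv p0013.txt:L24-27, L57-60), proof step] -/
theorem nodup_gridLists : ∀ n W : ℕ, (gridLists n W).Nodup
  | 0, _ => by simp [gridLists]
  | n + 1, W => by
    rw [gridLists]
    refine List.Nodup.map ?_ ((List.nodup_range).product (nodup_gridLists n W))
    rintro ⟨a, l⟩ ⟨b, m⟩ h
    simp only [List.cons.injEq] at h
    rw [h.1, h.2]

/-- Distinct indices below `(s+1)^k` give distinct exponent vectors. [cite: GuoKumarSaptharishiSolomon2019, §3.2–§3.3 (arXiv p0013.txt:L24-27, L57-60), proof step] -/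
theorem expFinsupp_injOn {k s : ℕ} {i j : ℕ} (hi : i < (s + 1) ^ k) (hj : j < (s + 1) ^ k)
    (h : expFinsupp k s i = expFinsupp k s j) : i = j := by
  have hlen := length_gridLists k (s + 1)
  have hi' : i < (gridLists k (s + 1)).length := by rw [hlen]; exact hi
  have hj' : j < (gridLists k (s + 1)).length := by rw [hlen]; exact hj
  have hli := mem_gridLists.mp (List.getElem_mem hi')
  have hlj := mem_gridLists.mp (List.getElem_mem hj')
  have heq : (gridLists k (s + 1))[i] = (gridLists k (s + 1))[j] := by
    refine List.ext_getElem (by rw [hli.1, hlj.1]) fun t h₁ h₂ => ?_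
    have := congrArg (fun e => e ⟨t, by rw [hli.1] at h₁; exact h₁⟩) h
    simp only [expFinsupp_apply, expVec, List.getD_eq_getElem _ _ hi',
      List.getD_eq_getElem _ _ hj'] at this
    rw [List.getD_eq_getElem _ _ h₁, List.getD_eq_getElem _ _ h₂] at this
    exact this
  exact (List.Nodup.getElem_inj_iff (nodup_gridLists k (s + 1))).mp heq

end Exponents

/-! ### The scaled integer evaluation matrix and its Gram matrices -/

section Gram

variable {k : ℕ}

/-- A point of the list, read as in `HittingSets.ListHits` (missing coordinates are `0`). [cite: GuoKumarSaptharishiSolomon2019, §1 (arXiv p0003.txt:L38)] -/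
def ptOf (k : ℕ) (a : List ℚ) : Fin k → ℚ := fun i => a.getD i.val 0

/-- The scaled integer value of the monomial `z^e` at a rational point `a`:
`∏_i num(a_i)^{e_i} · den(a_i)^{s - e_i} = (∏_i den(a_i)^s) · a^e` for `e ≤ s`. [cite: GuoKumarSaptharishiSolomon2019, Thm 15 (arXiv p0009.txt:L47-48), proof step] -/
def scaledEval (s : ℕ) (a : Fin k → ℚ) (e : Fin k → ℕ) : ℤ :=
  ∏ i, (a i).num ^ (e i) * ((a i).den : ℤ) ^ (s - e i)

/-- The common denominator `D_a = ∏_i den(a_i)^s`. [cite: GuoKumarSaptharishiSolomon2019, Thm 15 (arXiv p0009.txt:L47-48), proof step] -/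
def denomOf (s : ℕ) (a : Fin k → ℚ) : ℤ := ∏ i, ((a i).den : ℤ) ^ s

/-- `D_a > 0`. [folklore] -/
private theorem denomOf_pos (s : ℕ) (a : Fin k → ℚ) : 0 < denomOf s a :=
  Finset.prod_pos fun i _ => pow_pos (by exact_mod_cast (a i).den_pos) _

/-- `scaledEval s a e = D_a · a^e` in `ℚ`, for exponents `e ≤ s`. [folklore] -/
private theorem cast_scaledEval {s : ℕ} (a : Fin k → ℚ) {e : Fin k → ℕ} (he : ∀ i, e i ≤ s) :
    (scaledEval s a e : ℚ) = (denomOf s a : ℚ) * ∏ i, a i ^ e i := by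
  unfold scaledEval denomOf
  push_cast
  rw [← Finset.prod_mul_distrib]
  refine Finset.prod_congr rfl fun i _ => ?_
  obtain ⟨m, hm⟩ := Nat.exists_eq_add_of_le (he i)
  rw [← Rat.mul_den_eq_num (a i), hm, Nat.add_sub_cancel_left, pow_add, mul_pow]
  ring

/-- **The evaluation matrix** of the first `j` monomials (columns) at the points of `H` (rows),
scaled to integers. [cite: GuoKumarSaptharishiSolomon2019, Thm 15 and §3.3 (arXiv p0009.txt:L47-48, p0013.txt:L57-60)] -/
def evalMatrix (k s : ℕ) (H : List (List ℚ)) (j : ℕ) : Matrix (Fin H.length) (Fin j) ℤ :=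
  fun a i => scaledEval s (ptOf k H[(a : ℕ)]) (expVec k s i)

/-- **The Gram matrix** `Bᵀ B` of the first `j` columns. [cite: GuoKumarSaptharishiSolomon2019, Thm 15 (arXiv p0009.txt:L47-48), proof step] -/
def gram (k s : ℕ) (H : List (List ℚ)) (j : ℕ) : Matrix (Fin j) (Fin j) ℤ :=
  (evalMatrix k s H j)ᵀ * evalMatrix k s H j

/-- The leading block of a Gram matrix is the smaller Gram matrix. [folklore] -/
private theorem gram_submatrix_castSucc (k s : ℕ) (H : List (List ℚ)) (j : ℕ) :
    (gram k s H (j + 1)).submatrix Fin.castSucc Fin.castSucc = gram k s H j := by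
  ext u v
  simp [gram, Matrix.mul_apply, evalMatrix]

/-- The Gram matrix over `ℚ` is `Bᵀ B` for the rational evaluation matrix `B`. [folklore] -/
private theorem gram_map (k s : ℕ) (H : List (List ℚ)) (j : ℕ) :
    (gram k s H j).map (Int.castRingHom ℚ) =
      ((evalMatrix k s H j).map (Int.castRingHom ℚ))ᵀ * (evalMatrix k s H j).map (Int.castRingHom ℚ) := by
  rw [gram, Matrix.map_mul, Matrix.transpose_map]

/-- A Gram kernel vector is a kernel vector: `BᵀB x = 0 ⟹ B x = 0` (over `ℚ`). [folklore] -/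
private theorem evalMatrix_mulVec_eq_zero {s j : ℕ} {H : List (List ℚ)} {x : Fin j → ℤ}
    (hx : gram k s H j *ᵥ x = 0) :
    (evalMatrix k s H j).map (Int.castRingHom ℚ) *ᵥ ((Int.castRingHom ℚ) ∘ x) = 0 := by
  set B := (evalMatrix k s H j).map (Int.castRingHom ℚ) with hB
  set y : Fin j → ℚ := (Int.castRingHom ℚ) ∘ x with hy
  have h1 : Bᵀ *ᵥ (B *ᵥ y) = 0 := by
    rw [mulVec_mulVec, ← gram_map]
    funext u
    have h := RingHom.map_mulVec (Int.castRingHom ℚ) (gram k s H j) x u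
    rw [hx] at h
    rw [hy]
    simpa using h.symm
  have h2 : dotProduct (B *ᵥ y) (B *ᵥ y) = 0 := by
    have := congrArg (fun v => dotProduct y v) h1
    simp only [dotProduct_zero] at this
    rwa [dotProduct_mulVec, vecMul_transpose] at this
  exact dotProduct_self_eq_zero.mp h2

/-- More columns than rows: the full Gram matrix is singular. [cite: GuoKumarSaptharishiSolomon2019, Thm 15 (arXiv p0009.txt:L47-48), proof step] -/
theorem det_gram_eq_zero_of_lt {s j : ℕ} {H : List (List ℚ)} (hj : H.length < j) :
    (gram k s H j).det = 0 := by
  set B := (evalMatrix k s H j).map (Int.castRingHom ℚ) with hB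
  have hker : LinearMap.ker (Matrix.mulVecLin B) ≠ ⊥ := by
    apply LinearMap.ker_ne_bot_of_finrank_lt
    simp only [Module.finrank_fintype_fun_eq_card, Fintype.card_fin]
    exact hj
  obtain ⟨v, hv, hv0⟩ := Submodule.exists_mem_ne_zero_of_ne_bot hker
  rw [LinearMap.mem_ker, Matrix.mulVecLin_apply] at hv
  have hG : (Bᵀ * B) *ᵥ v = 0 := by rw [← mulVec_mulVec, hv, mulVec_zero]
  have hdet : (Bᵀ * B).det = 0 := Matrix.exists_mulVec_eq_zero_iff.mp ⟨v, hv0, hG⟩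
  have h := RingHom.map_det (Int.castRingHom ℚ) (gram k s H j)
  rw [RingHom.mapMatrix_apply, gram_map, ← hB, hdet, eq_intCast, Int.cast_eq_zero] at h
  exact h

end Gram

/-! ### The first singular Gram prefix and its adjugate kernel vector -/

section Kernel

variable {k : ℕ}

/-- The Gram determinants as a plain sequence `j ↦ det Gram_j`. [cite: GuoKumarSaptharishiSolomon2019, Thm 15 (arXiv p0009.txt:L47-48), proof step] -/
def gramDet (k s : ℕ) (H : List (List ℚ)) (j : ℕ) : ℤ := (gram k s H j).det

/-- **The first singular prefix**: the least `j ∈ [1, (s+1)^k]` such that the first `j` columns of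
the evaluation matrix are linearly dependent (`det Gram_j = 0`); `(s+1)^k + 1` if there is none.
[cite: GuoKumarSaptharishiSolomon2019, Thm 15 (arXiv p0009.txt:L47-48, "there is a nonzero polynomial … that vanishes on the hitting set")] -/
def firstSing (k s : ℕ) (H : List (List ℚ)) : ℕ :=
  (List.range ((s + 1) ^ k + 1)).findIdx fun j => decide (0 < j ∧ gramDet k s H j = 0)

/-- `firstSing ≤ (s+1)^k + 1`. [cite: GuoKumarSaptharishiSolomon2019, Thm 15 (arXiv p0009.txt:L47-48), proof step] -/
theorem firstSing_le (k s : ℕ) (H : List (List ℚ)) : firstSing k s H ≤ (s + 1) ^ k + 1 := by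
  have := List.findIdx_le_length (p := fun j => decide (0 < j ∧ gramDet k s H j = 0))
    (xs := List.range ((s + 1) ^ k + 1))
  simpa [firstSing] using this

/-- At the first singular prefix the Gram determinant vanishes (when a singular prefix exists). [cite: GuoKumarSaptharishiSolomon2019, Thm 15 (arXiv p0009.txt:L47-48), proof step] -/
theorem firstSing_spec {k s : ℕ} {H : List (List ℚ)} (h : firstSing k s H ≤ (s + 1) ^ k) :
    0 < firstSing k s H ∧ (gram k s H (firstSing k s H)).det = 0 := by
  unfold firstSing at h ⊢
  set p : ℕ → Bool := fun j => decide (0 < j ∧ gramDet k s H j = 0) with hp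
  have hlt : (List.range ((s + 1) ^ k + 1)).findIdx p < (List.range ((s + 1) ^ k + 1)).length := by
    rw [List.length_range]; exact Nat.lt_succ_of_le h
  have h1 := List.findIdx_getElem (p := p) (w := hlt)
  simp only [List.getElem_range, hp, decide_eq_true_eq] at h1
  exact h1

/-- Before the first singular prefix the Gram determinants are nonzero. [cite: GuoKumarSaptharishiSolomon2019, Thm 15 (arXiv p0009.txt:L47-48), proof step] -/
theorem det_gram_ne_zero_of_lt_firstSing {k s : ℕ} {H : List (List ℚ)} {j : ℕ} (hj0 : 0 < j)
    (hj : j < firstSing k s H) : (gram k s H j).det ≠ 0 := by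
  unfold firstSing at hj
  have h1 := List.not_of_lt_findIdx hj
  simp only [List.getElem_range, decide_eq_false_iff_not, not_and] at h1
  exact h1 hj0

/-- A short point list has a singular prefix: `|H| < (s+1)^k ⟹ firstSing ≤ (s+1)^k`. [cite: GuoKumarSaptharishiSolomon2019, Thm 15 (arXiv p0009.txt:L47-48), proof step] -/
theorem firstSing_le_of_lt {k s : ℕ} {H : List (List ℚ)} (hH : H.length < (s + 1) ^ k) :
    firstSing k s H ≤ (s + 1) ^ k := by
  by_contra hc
  have hlt : (s + 1) ^ k < firstSing k s H := by omega
  unfold firstSing at hlt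
  have h1 := List.not_of_lt_findIdx hlt
  simp only [List.getElem_range, decide_eq_false_iff_not, not_and] at h1
  exact h1 (Nat.pow_pos (Nat.succ_pos s)) (det_gram_eq_zero_of_lt hH)

/-- **The last adjugate column** of `Gram_{m+1}`. [cite: GuoKumarSaptharishiSolomon2019, Thm 15 (arXiv p0009.txt:L47-48), proof step] -/
def adjCol (k s : ℕ) (H : List (List ℚ)) (m : ℕ) (i : Fin (m + 1)) : ℤ :=
  (gram k s H (m + 1)).adjugate i (Fin.last m)

/-- Its last entry is the previous Gram determinant. [cite: GuoKumarSaptharishiSolomon2019, Thm 15 (arXiv p0009.txt:L47-48), proof step] -/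
theorem adjCol_last (k s : ℕ) (H : List (List ℚ)) (m : ℕ) :
    adjCol k s H m (Fin.last m) = (gram k s H m).det := by
  rw [adjCol, Matrix.adjugate_fin_succ_eq_det_submatrix, Fin.succAbove_last, gram_submatrix_castSucc]
  simp

/-- Reindexing the adjugate column along an equality of sizes. [folklore] -/
private theorem adjCol_congr (k s : ℕ) (H : List (List ℚ)) {n m : ℕ} (h : n = m) (i : ℕ) (hi : i < n + 1) :
    adjCol k s H n ⟨i, hi⟩ = adjCol k s H m ⟨i, by omega⟩ := by
  subst h; rfl

/-- A singular Gram matrix kills its adjugate columns: `Gram_{m+1} · adjCol = 0`. [cite: GuoKumarSaptharishiSolomon2019, Thm 15 (arXiv p0009.txt:L47-48), proof step] -/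
theorem gram_mulVec_adjCol {k s : ℕ} {H : List (List ℚ)} {m : ℕ} (hdet : (gram k s H (m + 1)).det = 0) :
    gram k s H (m + 1) *ᵥ adjCol k s H m = 0 := by
  funext u
  have h := congrArg (fun M => M u (Fin.last m)) (Matrix.mul_adjugate (gram k s H (m + 1)))
  simp only [Matrix.mul_apply, hdet, zero_smul, Matrix.zero_apply] at h
  simpa [mulVec, dotProduct, adjCol] using h

/-- Hence every row of the evaluation matrix is orthogonal to the adjugate column (over `ℚ`). [cite: GuoKumarSaptharishiSolomon2019, Thm 15 (arXiv p0009.txt:L47-48), proof step] -/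
theorem sum_evalMatrix_mul_adjCol {k s : ℕ} {H : List (List ℚ)} {m : ℕ}
    (hdet : (gram k s H (m + 1)).det = 0) (a : Fin H.length) :
    ∑ i : Fin (m + 1), (evalMatrix k s H (m + 1) a i : ℚ) * (adjCol k s H m i : ℚ) = 0 := by
  have h := congrFun (evalMatrix_mulVec_eq_zero (gram_mulVec_adjCol hdet)) a
  simpa [mulVec, dotProduct, Matrix.map_apply] using h

/-- **The kernel coefficients**: the adjugate column at the first singular prefix (zero if there is
no singular prefix, and past it). [cite: GuoKumarSaptharishiSolomon2019, Thm 15 (arXiv p0009.txt:L47-48)] -/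
def kerCoeff (k s : ℕ) (H : List (List ℚ)) (i : ℕ) : ℤ :=
  if h : i < firstSing k s H ∧ firstSing k s H ≤ (s + 1) ^ k then
    adjCol k s H (firstSing k s H - 1) ⟨i, by omega⟩
  else 0

/-- **The vanishing polynomial** `P_s = Σ_{i < j*} x_i z^{e_i}` of the point list `H`
(`x` the adjugate kernel vector of the first singular Gram prefix `j*`). This is the polynomial
"of individual degree at most `s` that vanishes on the hitting set" of GKSS ‹Thm 15›/§3.3, made
explicit. [cite: GuoKumarSaptharishiSolomon2019, Thm 15 and §3.3 (arXiv p0009.txt:L47-48, p0013.txt:L57-60)] -/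
def vanishingPoly (k s : ℕ) (H : List (List ℚ)) : MvPolynomial (Fin k) ℚ :=
  ∑ i ∈ Finset.range (firstSing k s H), monomial (expFinsupp k s i) (kerCoeff k s H i : ℚ)

end Kernel

/-! ### Properties: individual degree, vanishing on `H`, non-vanishing, hardness -/

section Properties

variable {k : ℕ}

/-- `P_s` has individual degree `≤ s`. [cite: GuoKumarSaptharishiSolomon2019, §3.3 (arXiv p0013.txt:L58-59, "of individual degree at most s")] -/
theorem degreeOf_vanishingPoly_le (k s : ℕ) (H : List (List ℚ)) (t : Fin k) :
    degreeOf t (vanishingPoly k s H) ≤ s := by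
  classical
  rw [degreeOf_le_iff]
  intro m hm
  rw [vanishingPoly] at hm
  obtain ⟨i, -, hi⟩ := Finset.mem_biUnion.mp (support_sum hm)
  have hmi : m = expFinsupp k s i := Finset.mem_singleton.mp (support_monomial_subset hi)
  rw [hmi, expFinsupp_apply]
  exact expVec_le k s i t

/-- `P_s` has total degree `≤ k·s`. [cite: GuoKumarSaptharishiSolomon2019, §3.3 (arXiv p0013.txt:L59, "total degree d ≤ ks")] -/
theorem totalDegree_vanishingPoly_le (k s : ℕ) (H : List (List ℚ)) :
    (vanishingPoly k s H).totalDegree ≤ k * s := by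
  classical
  rw [vanishingPoly]
  refine totalDegree_finsetSum_le fun i _ => (totalDegree_monomial_le _ _).trans ?_
  rw [Finsupp.sum_fintype _ _ (fun _ => rfl)]
  calc ∑ t, expFinsupp k s i t ≤ ∑ _t : Fin k, s :=
        Finset.sum_le_sum fun t _ => by rw [expFinsupp_apply]; exact expVec_le k s i t
    _ = k * s := by simp

/-- Evaluation of `P_s` at a point: `Σ_i x_i a^{e_i}`. [cite: GuoKumarSaptharishiSolomon2019, Thm 15 (arXiv p0009.txt:L47-48), proof step] -/
theorem eval_vanishingPoly (k s : ℕ) (H : List (List ℚ)) (p : Fin k → ℚ) :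
    eval p (vanishingPoly k s H) =
      ∑ i ∈ Finset.range (firstSing k s H), (kerCoeff k s H i : ℚ) * ∏ t, p t ^ expVec k s i t := by
  rw [vanishingPoly, map_sum]
  refine Finset.sum_congr rfl fun i _ => ?_
  rw [eval_monomial, Finsupp.prod_fintype _ _ (fun _ => by simp)]
  simp

/-- **`P_s` vanishes on `H`.** [cite: GuoKumarSaptharishiSolomon2019, Thm 15 and §3.3 (arXiv p0009.txt:L47-48 "vanishes on the hitting set", p0013.txt:L57-60)] -/
theorem eval_vanishingPoly_eq_zero (k s : ℕ) {H : List (List ℚ)} {a : List ℚ} (ha : a ∈ H) :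
    eval (ptOf k a) (vanishingPoly k s H) = 0 := by
  classical
  rw [eval_vanishingPoly]
  by_cases hfound : firstSing k s H ≤ (s + 1) ^ k
  · obtain ⟨hpos, hdet⟩ := firstSing_spec hfound
    obtain ⟨m, hm⟩ : ∃ m, firstSing k s H = m + 1 := ⟨firstSing k s H - 1, by omega⟩
    obtain ⟨n, hn, rfl⟩ := List.getElem_of_mem ha
    rw [hm] at hdet
    have hD : (denomOf s (ptOf k H[n]) : ℚ) ≠ 0 := by exact_mod_cast (denomOf_pos s _).ne'
    have key := sum_evalMatrix_mul_adjCol hdet ⟨n, hn⟩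
    have hterm : ∀ i : Fin (m + 1),
        (evalMatrix k s H (m + 1) ⟨n, hn⟩ i : ℚ) * (adjCol k s H m i : ℚ) =
          (denomOf s (ptOf k H[n]) : ℚ) *
            ((kerCoeff k s H i : ℚ) * ∏ t, ptOf k H[n] t ^ expVec k s i t) := fun i => by
      have hc : kerCoeff k s H i = adjCol k s H m i := by
        rw [kerCoeff, dif_pos ⟨by omega, hfound⟩,
          adjCol_congr k s H (show firstSing k s H - 1 = m by omega)]
      rw [evalMatrix, cast_scaledEval _ (expVec_le k s i), hc]
      ring
    rw [Finset.sum_congr rfl fun i _ => hterm i, ← Finset.mul_sum] at key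
    rw [hm, Finset.sum_range]
    exact (mul_eq_zero.mp key).resolve_left hD
  · refine Finset.sum_eq_zero fun i hi => ?_
    rw [kerCoeff, dif_neg (fun h => hfound h.2)]
    simp

/-- **`P_s ≠ 0` for a short point list** (`|H| < (s+1)^k`): the coefficient of `z^{e_{j*-1}}` is
`det Gram_{j*-1} ≠ 0`. [cite: GuoKumarSaptharishiSolomon2019, Thm 15 (arXiv p0009.txt:L47-48, "(d'+1)^k > |H| … nonzero polynomial")] -/
theorem vanishingPoly_ne_zero (k s : ℕ) {H : List (List ℚ)} (hH : H.length < (s + 1) ^ k) :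
    vanishingPoly k s H ≠ 0 := by
  classical
  have hfound := firstSing_le_of_lt hH
  obtain ⟨hpos, hdet⟩ := firstSing_spec hfound
  obtain ⟨m, hm⟩ : ∃ m, firstSing k s H = m + 1 := ⟨firstSing k s H - 1, by omega⟩
  intro h0
  have hc := congrArg (coeff (expFinsupp k s m)) h0
  rw [vanishingPoly, coeff_sum, coeff_zero, Finset.sum_eq_single m, coeff_monomial, if_pos rfl] at hc
  · have hker : kerCoeff k s H m = (gram k s H m).det := by
      rw [kerCoeff, dif_pos ⟨by omega, hfound⟩, ← adjCol_last,
        adjCol_congr k s H (show firstSing k s H - 1 = m by omega)]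
      rfl
    rw [hker, Int.cast_eq_zero] at hc
    rcases Nat.eq_zero_or_pos m with hm0 | hm0
    · subst hm0
      simp [Matrix.det_fin_zero] at hc
    · exact det_gram_ne_zero_of_lt_firstSing hm0 (by omega) hc
  · intro i hi him
    rw [coeff_monomial, if_neg]
    intro he
    have hi' : i < (s + 1) ^ k := lt_of_lt_of_le (Finset.mem_range.mp hi) hfound
    exact him (expFinsupp_injOn hi' (by omega) he)
  · intro hm'
    exact absurd (Finset.mem_range.mpr (by omega)) hm'

/-- With no singular prefix all kernel coefficients vanish and `P_s = 0`. [cite: GuoKumarSaptharishiSolomon2019, Thm 15 (arXiv p0009.txt:L47-48), proof step] -/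
theorem vanishingPoly_eq_zero_of_lt {k s : ℕ} {H : List (List ℚ)} (h : (s + 1) ^ k < firstSing k s H) :
    vanishingPoly k s H = 0 := by
  rw [vanishingPoly]
  refine Finset.sum_eq_zero fun i _ => ?_
  rw [kerCoeff, dif_neg (fun h' => absurd h'.2 (by omega))]
  simp

/-- **The coefficients of `P_s`**: the coefficient of `z^{e_i}` (`i < (s+1)^k`) is the kernel
coefficient `x_i`. [cite: GuoKumarSaptharishiSolomon2019, Thm 15 (arXiv p0009.txt:L47-48), proof step] -/
theorem coeff_vanishingPoly {k s : ℕ} (H : List (List ℚ)) {i : ℕ} (hi : i < (s + 1) ^ k) :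
    coeff (expFinsupp k s i) (vanishingPoly k s H) = kerCoeff k s H i := by
  classical
  by_cases hfound : firstSing k s H ≤ (s + 1) ^ k
  · rw [vanishingPoly, coeff_sum]
    by_cases hiJ : i < firstSing k s H
    · rw [Finset.sum_eq_single i, coeff_monomial, if_pos rfl]
      · intro j hj hji
        rw [coeff_monomial, if_neg]
        intro he
        exact hji (expFinsupp_injOn (lt_of_lt_of_le (Finset.mem_range.mp hj) hfound) hi he)
      · intro hi'; exact absurd (Finset.mem_range.mpr hiJ) hi'
    · rw [Finset.sum_eq_zero, kerCoeff, dif_neg (fun h' => hiJ h'.1), Int.cast_zero]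
      intro j hj
      rw [coeff_monomial, if_neg]
      intro he
      have hj' := Finset.mem_range.mp hj
      exact hiJ (expFinsupp_injOn (lt_of_lt_of_le hj' hfound) hi he ▸ hj')
  · rw [vanishingPoly_eq_zero_of_lt (not_le.mp hfound), coeff_zero, kerCoeff,
      dif_neg (fun h' => hfound h'.2), Int.cast_zero]

/-- **The support of `P_s`**: every monomial of `P_s` is `z^{e_i}` for some `i < j* ≤ (s+1)^k` with
`x_i ≠ 0`. [cite: GuoKumarSaptharishiSolomon2019, Thm 15 (arXiv p0009.txt:L47-48), proof step] -/
theorem exists_of_mem_support_vanishingPoly {k s : ℕ} {H : List (List ℚ)} {m : Fin k →₀ ℕ}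
    (hm : m ∈ (vanishingPoly k s H).support) :
    ∃ i, i < firstSing k s H ∧ i < (s + 1) ^ k ∧ m = expFinsupp k s i ∧ kerCoeff k s H i ≠ 0 := by
  classical
  by_cases hfound : firstSing k s H ≤ (s + 1) ^ k
  · have hm' := hm
    rw [vanishingPoly] at hm'
    obtain ⟨i, hi, him⟩ := Finset.mem_biUnion.mp (support_sum hm')
    have hmi : m = expFinsupp k s i := Finset.mem_singleton.mp (support_monomial_subset him)
    have hiJ := Finset.mem_range.mp hi
    have hiN : i < (s + 1) ^ k := lt_of_lt_of_le hiJ hfound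
    refine ⟨i, hiJ, hiN, hmi, fun h0 => ?_⟩
    have hc := mem_support_iff.mp hm
    rw [hmi, coeff_vanishingPoly H hiN, h0, Int.cast_zero] at hc
    exact hc rfl
  · rw [vanishingPoly_eq_zero_of_lt (not_le.mp hfound), support_zero] at hm
    simp at hm

/-- **Hardness of `P_s`**: if `H` hits `𝒞(k, i-deg: s, t)` and `|H| < (s+1)^k`, then `P_s` — nonzero,
of individual degree `≤ s`, vanishing on `H` — "cannot be computed by circuits of size `t`".
[cite: GuoKumarSaptharishiSolomon2019, Thm 15 and §3.3 (arXiv p0009.txt:L47-48, p0013.txt:L57-60 "cannot be computed by circuits of size s^δ")] -/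
theorem lt_complexity_vanishingPoly (k s : ℕ) {t : ℝ} {H : List (List ℚ)}
    (hhit : ListHits H (idegSlice ℚ k s t)) (hH : H.length < (s + 1) ^ k) :
    t < (complexity (vanishingPoly k s H) : ℝ) := by
  by_contra hle
  have hmem : vanishingPoly k s H ∈ idegSlice ℚ k s t :=
    ⟨degreeOf_vanishingPoly_le k s H, not_lt.mp hle⟩
  obtain ⟨a, ha, hne⟩ := hhit _ hmem (vanishingPoly_ne_zero k s hH)
  exact hne (eval_vanishingPoly_eq_zero k s ha)

end Properties

/-! ### The exact-degree family `P'_d = z_0^d + P_{s(d)}(z_1, …, z_k)` fed to ‹Thm 5› -/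

section Family

variable {k : ℕ}

/-- The hypothesis index used at degree `d`: `s(d) = ⌊(d-1)/k⌋`, so that `k·s(d) ≤ d - 1`. [cite: GuoKumarSaptharishiSolomon2019, §3.3 (arXiv p0013.txt:L56 – p0014.txt:L8), proof step] -/
def sOf (k d : ℕ) : ℕ := (d - 1) / k

/-- `k · s(d) ≤ d - 1`. [folklore] -/
private theorem mul_sOf_le (k d : ℕ) : k * sOf k d ≤ d - 1 := by
  rw [sOf, mul_comm]; exact Nat.div_mul_le_self _ _

/-- **The padded family** `P'_d = z_0^d + P_{s(d)}(z_1..z_k) ∈ ℚ[z_0, …, z_k]` — the vanishing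
polynomial of the `s(d)`-th hitting set, moved to the variables `z_1..z_k`, plus the monomial
`z_0^d` forcing total degree EXACTLY `d` (the typed ‹Thm 5› asks `deg P_d = d` for every `d`;
print indexes the family by `s`). [cite: GuoKumarSaptharishiSolomon2019, §3.3 (arXiv p0014.txt:L5-6, "{P_s} is an explicit family of k-variate, degree-d polynomials")] -/
def bootFamily (k : ℕ) (H₀ : ℕ → List (List ℚ)) (d : ℕ) : MvPolynomial (Fin (k + 1)) ℚ :=
  X 0 ^ d + rename Fin.succ (vanishingPoly k (sOf k d) (H₀ (sOf k d)))

/-- The moved vanishing polynomial has degree `< d`. [folklore] -/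
private theorem totalDegree_rename_vanishingPoly_lt {d : ℕ} (hd : 1 ≤ d) (H : List (List ℚ)) :
    (rename Fin.succ (vanishingPoly k (sOf k d) H) : MvPolynomial (Fin (k + 1)) ℚ).totalDegree < d :=
  calc (rename Fin.succ (vanishingPoly k (sOf k d) H)).totalDegree
      ≤ (vanishingPoly k (sOf k d) H).totalDegree := totalDegree_rename_le _ _
    _ ≤ k * sOf k d := totalDegree_vanishingPoly_le _ _ _
    _ < d := by have := mul_sOf_le k d; omega

/-- **`deg P'_d = d`** for `d ≥ 1`. [cite: GuoKumarSaptharishiSolomon2019, Thm 5 hypothesis "deg(P_{k,d}) = d" (arXiv p0005.txt:L29)] -/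
theorem totalDegree_bootFamily (H₀ : ℕ → List (List ℚ)) {d : ℕ} (hd : 1 ≤ d) :
    (bootFamily k H₀ d).totalDegree = d := by
  rw [bootFamily, totalDegree_add_eq_left_of_totalDegree_lt]
  · exact totalDegree_X_pow _ _
  · rw [totalDegree_X_pow]; exact totalDegree_rename_vanishingPoly_lt hd _

/-- Killing the padding variable recovers the moved vanishing polynomial. [folklore] -/
private theorem aeval_update_bootFamily (H₀ : ℕ → List (List ℚ)) {d : ℕ} (hd : 1 ≤ d) :
    aeval (Function.update X 0 (C (0 : ℚ))) (bootFamily k H₀ d) =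
      rename Fin.succ (vanishingPoly k (sOf k d) (H₀ (sOf k d))) := by
  have h0 : (C (0 : ℚ) : MvPolynomial (Fin (k + 1)) ℚ) ^ d = 0 := by
    rw [C_0, zero_pow (by omega)]
  have h : (Function.update X 0 (C (0 : ℚ))) ∘ Fin.succ =
      (X ∘ Fin.succ : Fin k → MvPolynomial (Fin (k + 1)) ℚ) := by
    funext i; simp
  rw [bootFamily, map_add, map_pow, aeval_X, Function.update_self, h0, zero_add, aeval_rename, h,
    ← aeval_X_left_apply (rename Fin.succ _), aeval_rename]

/-- **Hardness transfers to the padded family**: `L(P_{s(d)}) ≤ L(P'_d)` (substitute `z_0 := 0`,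
which is free, and rename). [cite: GuoKumarSaptharishiSolomon2019, §3.3 (arXiv p0014.txt:L5-6)] -/
theorem complexity_vanishingPoly_le_bootFamily (H₀ : ℕ → List (List ℚ)) {d : ℕ} (hd : 1 ≤ d) :
    complexity (vanishingPoly k (sOf k d) (H₀ (sOf k d))) ≤ complexity (bootFamily k H₀ d) := by
  classical
  calc complexity (vanishingPoly k (sOf k d) (H₀ (sOf k d)))
      = complexity (rename Fin.succ (vanishingPoly k (sOf k d) (H₀ (sOf k d))) :
          MvPolynomial (Fin (k + 1)) ℚ) :=
        (complexity_rename_of_injective_holds (Fin.succ_injective k) _).symm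
    _ = complexity (aeval (Function.update X 0 (C (0 : ℚ))) (bootFamily k H₀ d)) := by
        rw [aeval_update_bootFamily H₀ hd]
    _ ≤ complexity (bootFamily k H₀ d) := complexity_subst_C_le _ _ _

/-- Elementary growth: `d ≥ 4k²`, `d ≥ k s₀ + 1`, `0 < k` give `s(d) ≥ s₀` and `d^{δ/2} ≤ s(d)^δ`. [folklore] -/
private theorem rpow_half_le_sOf_rpow {k d : ℕ} (hk : 0 < k) {δ : ℝ} (hδ : 0 < δ) (hd : 4 * k ^ 2 ≤ d) :
    (d : ℝ) ^ (δ / 2) ≤ (sOf k d : ℝ) ^ δ := by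
  have hk' : (0 : ℝ) < k := by exact_mod_cast hk
  have hd1 : 2 * k ≤ d := le_trans (by nlinarith) hd
  -- `s(d) ≥ d / (2k)` as reals
  have hks : d ≤ 2 * (k * sOf k d) := by
    have h1 := Nat.div_add_mod (d - 1) k
    have h2 := Nat.mod_lt (d - 1) hk
    rw [sOf]; omega
  have hs : (d : ℝ) / (2 * k) ≤ (sOf k d : ℝ) := by
    rw [div_le_iff₀ (by positivity)]
    have : ((d : ℕ) : ℝ) ≤ ((2 * (k * sOf k d) : ℕ) : ℝ) := by exact_mod_cast hks
    push_cast at this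
    linarith
  have hD : (0 : ℝ) ≤ d := Nat.cast_nonneg d
  have hq : (0 : ℝ) ≤ (d : ℝ) / (2 * k) := by positivity
  -- `d ≤ (d / (2k))²`
  have hsq : (d : ℝ) ≤ ((d : ℝ) / (2 * k)) ^ (2 : ℝ) := by
    rw [Real.rpow_two, div_pow, le_div_iff₀ (by positivity)]
    have h4 : (4 * k ^ 2 : ℝ) ≤ d := by exact_mod_cast hd
    nlinarith
  calc (d : ℝ) ^ (δ / 2) ≤ (((d : ℝ) / (2 * k)) ^ (2 : ℝ)) ^ (δ / 2) :=
        Real.rpow_le_rpow hD hsq (by positivity)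
    _ = ((d : ℝ) / (2 * k)) ^ δ := by rw [← Real.rpow_mul hq]; ring_nf
    _ ≤ (sOf k d : ℝ) ^ δ := Real.rpow_le_rpow hq hs hδ.le

/-- **Eventual hardness of the padded family**: if for all `s ≥ s₀` the list `H₀ s` has at most
`(s+1)^k - 1` points and hits `𝒞(k, i-deg: s, s^δ)`, then `d^{δ/2} ≤ L(P'_d)` for all large `d`
(print: "`P_s` … requires circuits of size more than `(d/k)^δ ≫ d^{δ/2}`").
[cite: GuoKumarSaptharishiSolomon2019, §3.3 (arXiv p0013.txt:L59 – p0014.txt:L5)] -/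
theorem eventually_hard_bootFamily {k : ℕ} (hk : 0 < k) {δ : ℝ} (hδ : 0 < δ) {H₀ : ℕ → List (List ℚ)}
    {s₀ : ℕ} (hH₀ : ∀ s, s₀ ≤ s → (H₀ s).length ≤ (s + 1) ^ k - 1 ∧
      ListHits (H₀ s) (idegSlice ℚ k s ((s : ℝ) ^ δ))) :
    ∃ d₀ : ℕ, ∀ d, d₀ ≤ d → (d : ℝ) ^ (δ / 2) ≤ (complexity (bootFamily k H₀ d) : ℝ) := by
  refine ⟨max (k * s₀ + 1) (4 * k ^ 2), fun d hd => ?_⟩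
  have hd1 : k * s₀ + 1 ≤ d := le_trans (le_max_left _ _) hd
  have hd2 : 4 * k ^ 2 ≤ d := le_trans (le_max_right _ _) hd
  have hs₀ : s₀ ≤ sOf k d := by
    rw [sOf, Nat.le_div_iff_mul_le hk]
    have : s₀ * k = k * s₀ := mul_comm _ _
    omega
  obtain ⟨hlen, hhit⟩ := hH₀ _ hs₀
  have hlt : (H₀ (sOf k d)).length < (sOf k d + 1) ^ k := by
    have : 0 < (sOf k d + 1) ^ k := Nat.pow_pos (by omega); omega
  have h1 := lt_complexity_vanishingPoly k (sOf k d) hhit hlt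
  have h2 := complexity_vanishingPoly_le_bootFamily (k := k) H₀ (show 1 ≤ d by omega)
  calc (d : ℝ) ^ (δ / 2) ≤ (sOf k d : ℝ) ^ δ := rpow_half_le_sOf_rpow hk hδ hd2
    _ ≤ (complexity (vanishingPoly k (sOf k d) (H₀ (sOf k d))) : ℝ) := h1.le
    _ ≤ (complexity (bootFamily k H₀ d) : ℝ) := by exact_mod_cast h2

end Family

end GKSS2019

end Literature.Computability.AlgebraicComplexity

end
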